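import Summits.QuantumFields.BalabanUV.Beta.FP.PerfectPropagatorKernelGradedChain
import Summits.QuantumFields.BalabanUV.Beta.FP.PerfectPropagatorKernelLegs

/-!
# `BalabanUV.Beta.FP.PerfectPropagatorKernelGraded` — road «FP» for binder row D1, leaf H2-P of the horizontal route, row H2-P-KER-ASM v1.1 (R-FP-21 (B3),
# owner NEXT l.22424, holder gan24-formalise-leaf-05-g35 INTENT l.22570), PART V2b: **(K2)∕(K3) AT THE EXPONENTS OF RECORD** — the first and mixed second
# lattice differences of the perfect propagator's remainder kernel `KB` decay like `‖z‖_∞^{−4}` and `‖z‖_∞^{−5}` (lattice dimension `d + 1 ≥ 4`), by FOUR resp.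
# FIVE integrations by parts on the differenced symbols `(e^{ip_μ} − 1)·B` and `(e^{ip_ν} − 1)(e^{ip_μ} − 1)·B` along the graded product chains of PART V2a.

HONEST DEPENDENCY (page 1, mandatory): continuum YM on T⁴ ⇐ BetaPertH ∧ nine spine estimates (0/9 proved); BetaPertH ⇐ (D1) ∧ (D4) ∧ CAP+tail;
G-an2-4 gates asym, D1 and NE2/3/4.  HONEST FRAMING (cell contract, verbatim): «discharging `BetaPertH` makes Bałaban's UV stability UNCONDITIONAL —
a real constructive-QFT result; it is NOT the continuum limit and NOT the Clay problem.»  THIS MODULE DISCHARGES NOTHING of the wall: [folklore] harmonic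
analysis + [our object] assembly BY NAME over the road's own `k = ∞` objects — gan24-formalise-leaf-05-g35's (C) `FP/PerfectPropagatorKernel` (`symB`, `KB`,
`symB_slice_eq`, `integrableOn_integrand_symB`) and IBP tool `FP/PuncturedCoordDerivMajorant.norm_latticeKernel_le_div_supNorm_pow_of_majorant`, g34's
`FP/PuncturedCoordDeriv.latticeKernel_fwdDiff`, `FP/BrillouinRadial.integrableOn_inv_norm_pow_BZ`, (D) `FP/PerfectPropagatorKernelLegs.one_le_supNorm`, PART V1
`FP/LatticeKernelShiftChain` and PART V2a
`FP/PerfectPropagatorKernelGradedChain` (this lineage).  Constants existential-grade (through `KremP` and `∫_{BZ}(‖s‖³)⁻¹`).  0 `def … : Prop`; nothing cited;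
0 sorry; 0 estimates of Bałaban's CONSTRAINED kernels; 0 wall binders; NOT D1, NEVER «G-an2-4 closed», NOT BetaPertH, NOT continuum, NOT Clay.

ABSOLUTE RULE (cell charter, verbatim): «No internally-minted statement may enter as a cited fact. Every hypothesis is either kernel-proved in this package or a
verbatim quotation of a PUBLISHED theorem with page reference. The manuscript(s) under audit are NOT citable for their own disputed steps — they are the thing
under adjudication; programme-internal (2001/route/tribunal) claims are never citable.»

WHAT (lattice dimension `d + 1`; shift directions `μ, ν`, slice coordinate `i`, slices off the null set `{q = 0}` of transverse momenta):
* §4 [our object] THE CHAINS OF RECORD `D1N μ i α β` ∕ `D2N μ ν i α β` (member `0` = the differenced symbol `(e^{ip_μ} − 1)·symB` resp.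
  `(e^{ip_ν} − 1)((e^{ip_μ} − 1)·symB)` LITERALLY, members `≥ 1` = the product families of PART V2a; junction on punctured slices by (C)'s `symB_slice_eq` +
  `remSlN_zero_eq_remSl0`), their five IBP rows at `r = 4` resp. `r = 5` (`*_hder`, `*_hcont`, `*_hper`, `*_hmeas`, `*_hmaj`) with the majorants
  `2⁴·KremPmax d·π⁴·(‖s‖³)⁻¹`, `2⁵·(2⁵π⁵·KremPmax d)·π⁵·(‖s‖³)⁻¹ ∈ L¹(BZ (d+1))` (`3 ≤ d`).
* §5 [our object] `CKB₂ d`, `CKB₃ d` and THE RESULTS: **(K2) `norm_KB_fwdDiff_le_div_pow_four (hd : 3 ≤ d) (α β μ) (hz : z ≠ 0) :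
  ‖KB α β (z + e_μ) − KB α β z‖ ≤ CKB₂ d ∕ ‖z‖_∞⁴`**, **(K3) `norm_KB_fwdDiff₂_le_div_pow_five (hd : 3 ≤ d) (α β μ ν) (hz : z ≠ 0) :
  ‖KB α β (z + e_μ + e_ν) − KB α β (z + e_μ) − KB α β (z + e_ν) + KB α β z‖ ≤ CKB₃ d ∕ ‖z‖_∞⁵`** (`‖z‖_∞ = B4ContourShift.supNorm z`, `e_μ = Pi.single μ 1`);
  (the exponent-3 versions (K2′)∕(K3′) are gan24-formalise-leaf-05-g35's `PerfectPropagatorKernelLegs.norm_KB_fwdDiff_le`∕`norm_KB_fwdDiff₂_le`).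
* §6 [our object] ALL-`z` LETTERS in the consumers' currency: `CKB₂_nonneg`, `CKB₃_nonneg`, **`norm_KB_fwdDiff_le_inv_succ_pow_four`**
  (`≤ 16·(CKB₂ d + 2·CB0 d)∕(‖z‖_∞ + 1)⁴`, every `z`), **`norm_KB_fwdDiff₂_le_inv_succ_pow_five`** (`≤ 32·(CKB₃ d + 4·CB0 d)∕(‖z‖_∞ + 1)⁵`, every `z`).

Provenance: binder row D1 formalisation swarm, lineage beta-d1-formalise-leaf-01, gen 9 (prover-b2b-balaban-beta-d1-formalise-leaf-01-g9-0), 2026-08-20;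
road FP (owner b2b-balaban-beta-d1-p3, NEXT FOR THE ROW l.22424), row H2-P-KER-ASM (holder gan24-formalise-leaf-05-g35, INTENT l.22570); OFFER l.22410, REPLY l.22585.
-/

noncomputable section

namespace Summit.QuantumFields.BalabanUV.Beta.FP.PerfectPropagatorKernelGraded

open MeasureTheory Set Complex Filter Topology Finset
open scoped Real BigOperators
open Literature.MathematicalPhysics.QuantumFieldTheory.Balaban1983to89
open B4Strip (ofRealVec)
open B4ContourShift (BZ integrand latticeKernel supNorm ofRealVec_insertNth)
open B4BoxCov237 (supNorm_zero')
open Summit.QuantumFields.BalabanUV.Beta.FP.PerfectPropagatorKernel (symB KB symB_slice_eq integrableOn_integrand_symB CB0 CB0_nonneg norm_KB_le)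
open Summit.QuantumFields.BalabanUV.Beta.FP.PerfectPropagatorKernelLegs (one_le_supNorm)
open Summit.QuantumFields.BalabanUV.Beta.FP.RemainderSymbolSliceN (remSlN_zero_eq_remSl0)
open Summit.QuantumFields.BalabanUV.Beta.FP.LatticeKernelShiftChain (prodN prodN_zero integrableOn_integrand_chi_mul latticeKernel_fwdDiff₂)
open Summit.QuantumFields.BalabanUV.Beta.FP.PerfectPropagatorKernelGradedChain (KremPmax memN memN_slice E1_hder E1_hcont E1_hper E1_letter E2_hder E2_hcont
  E2_hper E2_letter)
open Summit.QuantumFields.BalabanUV.Beta.FP.PuncturedCoordDeriv (latticeKernel_fwdDiff)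
open Summit.QuantumFields.BalabanUV.Beta.FP.PuncturedCoordDerivMajorant (norm_latticeKernel_le_div_supNorm_pow_of_majorant)
open Summit.QuantumFields.BalabanUV.Beta.FP.BrillouinRadial (integrableOn_inv_norm_pow_BZ)

variable {d : ℕ}

/-! ## §4 The chains of record (member `0` = the differenced symbols, literally) and their IBP rows -/

/-- [our object] THE ONE-CHARACTER CHAIN OF RECORD in the coordinate `i`: member `0` IS the differenced symbol `(e^{ip_μ} − 1)·symB`, members `k ≥ 1` the
product family. -/
def D1N (μ i α β : Fin (d + 1)) : ℕ → (Fin (d + 1) → ℂ) → ℂ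
  | 0 => fun P => (cexp (I * P μ) - 1) * symB α β P
  | k + 1 => prodN (memN i α β) μ i (k + 1)

/-- [our object] THE TWO-CHARACTER CHAIN OF RECORD: member `0` IS `(e^{ip_ν} − 1)·((e^{ip_μ} − 1)·symB)`, members `k ≥ 1` the two-character family. -/
def D2N (μ ν i α β : Fin (d + 1)) : ℕ → (Fin (d + 1) → ℂ) → ℂ
  | 0 => fun P => (cexp (I * P ν) - 1) * ((cexp (I * P μ) - 1) * symB α β P)
  | k + 1 => prodN (prodN (memN i α β) μ i) ν i (k + 1)

section Chains

variable {μ ν i α β : Fin (d + 1)} {q : Fin d → ℝ}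

/-- [our object] THE JUNCTION: on a punctured slice member `0` of `D1N` is member `0` of the product family ((C)'s `symB_slice_eq` + `remSlN_zero_eq_remSl0`). -/
theorem D1N_zero_slice (hq : q ∈ BZ d) (hq0 : q ≠ 0) {t : ℝ} (ht : t ∈ Icc (-π) π) :
    D1N μ i α β 0 (i.insertNth (t : ℂ) (ofRealVec q)) = prodN (memN i α β) μ i 0 (i.insertNth (t : ℂ) (ofRealVec q)) := by
  simp only [D1N]
  rw [prodN_zero, symB_slice_eq hq hq0 ht, memN_slice, remSlN_zero_eq_remSl0]

/-- [our object] the junction for the two-character chain. -/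
theorem D2N_zero_slice (hq : q ∈ BZ d) (hq0 : q ≠ 0) {t : ℝ} (ht : t ∈ Icc (-π) π) :
    D2N μ ν i α β 0 (i.insertNth (t : ℂ) (ofRealVec q)) = prodN (prodN (memN i α β) μ i) ν i 0 (i.insertNth (t : ℂ) (ofRealVec q)) := by
  simp only [D2N]
  rw [prodN_zero, prodN_zero, symB_slice_eq hq hq0 ht, memN_slice, remSlN_zero_eq_remSl0]

/-- [our object] `hder` rows of `D1N` at `r = 4`. -/
theorem D1N_hder (hq : q ∈ BZ d) (hq0 : q ≠ 0) : ∀ j < 4, ∀ t ∈ Ioo (-π) π,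
    HasDerivAt (fun s : ℝ => D1N μ i α β j (i.insertNth (s : ℂ) (ofRealVec q))) (D1N μ i α β (j + 1) (i.insertNth (t : ℂ) (ofRealVec q))) t := by
  intro j hj t ht
  rcases j with _ | j
  · have hev : (fun s : ℝ => D1N μ i α β 0 (i.insertNth (s : ℂ) (ofRealVec q)))
        =ᶠ[𝓝 t] fun s : ℝ => prodN (memN i α β) μ i 0 (i.insertNth (s : ℂ) (ofRealVec q)) :=
      Filter.eventuallyEq_of_mem (isOpen_Ioo.mem_nhds ht) fun s hs => D1N_zero_slice hq hq0 (Ioo_subset_Icc_self hs)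
    exact (E1_hder hq hq0 (k := 0) (by norm_num) ht).congr_of_eventuallyEq hev
  · exact E1_hder hq hq0 (by omega) ht

/-- [our object] `hcont` rows of `D1N` at `r = 4`. -/
theorem D1N_hcont (hq : q ∈ BZ d) (hq0 : q ≠ 0) : ∀ j < 4,
    ContinuousOn (fun s : ℝ => D1N μ i α β j (i.insertNth (s : ℂ) (ofRealVec q))) (uIcc (-π) π) := by
  intro j hj
  rcases j with _ | j
  · refine (E1_hcont (μ := μ) (i := i) (α := α) (β := β) hq hq0 (k := 0) (by norm_num)).congr fun s hs => ?_
    rw [Set.uIcc_of_le (by linarith [Real.pi_pos])] at hs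
    exact D1N_zero_slice hq hq0 hs
  · exact E1_hcont hq hq0 (by omega)

/-- [our object] `hper` rows of `D1N` at `r = 4`. -/
theorem D1N_hper (hq : q ∈ BZ d) (hq0 : q ≠ 0) : ∀ j < 4,
    D1N μ i α β j (i.insertNth (((-π : ℝ)) : ℂ) (ofRealVec q)) = D1N μ i α β j (i.insertNth ((π : ℝ) : ℂ) (ofRealVec q)) := by
  have hππ : -π ≤ π := by linarith [Real.pi_pos]
  intro j hj
  rcases j with _ | j
  · rw [D1N_zero_slice hq hq0 ⟨le_rfl, hππ⟩, D1N_zero_slice hq hq0 ⟨hππ, le_rfl⟩]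
    exact E1_hper hq 0
  · exact E1_hper hq (j + 1)

/-- [our object] `hder` rows of `D2N` at `r = 5`. -/
theorem D2N_hder (hq : q ∈ BZ d) (hq0 : q ≠ 0) : ∀ j < 5, ∀ t ∈ Ioo (-π) π,
    HasDerivAt (fun s : ℝ => D2N μ ν i α β j (i.insertNth (s : ℂ) (ofRealVec q))) (D2N μ ν i α β (j + 1) (i.insertNth (t : ℂ) (ofRealVec q))) t := by
  intro j hj t ht
  rcases j with _ | j
  · have hev : (fun s : ℝ => D2N μ ν i α β 0 (i.insertNth (s : ℂ) (ofRealVec q)))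
        =ᶠ[𝓝 t] fun s : ℝ => prodN (prodN (memN i α β) μ i) ν i 0 (i.insertNth (s : ℂ) (ofRealVec q)) :=
      Filter.eventuallyEq_of_mem (isOpen_Ioo.mem_nhds ht) fun s hs => D2N_zero_slice hq hq0 (Ioo_subset_Icc_self hs)
    exact (E2_hder hq hq0 (k := 0) (by norm_num) ht).congr_of_eventuallyEq hev
  · exact E2_hder hq hq0 (by omega) ht

/-- [our object] `hcont` rows of `D2N` at `r = 5`. -/
theorem D2N_hcont (hq : q ∈ BZ d) (hq0 : q ≠ 0) : ∀ j < 5,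
    ContinuousOn (fun s : ℝ => D2N μ ν i α β j (i.insertNth (s : ℂ) (ofRealVec q))) (uIcc (-π) π) := by
  intro j hj
  rcases j with _ | j
  · refine (E2_hcont (μ := μ) (ν := ν) (i := i) (α := α) (β := β) hq hq0 (k := 0) (by norm_num)).congr fun s hs => ?_
    rw [Set.uIcc_of_le (by linarith [Real.pi_pos])] at hs
    exact D2N_zero_slice hq hq0 hs
  · exact E2_hcont hq hq0 (by omega)

/-- [our object] `hper` rows of `D2N` at `r = 5`. -/
theorem D2N_hper (hq : q ∈ BZ d) (hq0 : q ≠ 0) : ∀ j < 5,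
    D2N μ ν i α β j (i.insertNth (((-π : ℝ)) : ℂ) (ofRealVec q)) = D2N μ ν i α β j (i.insertNth ((π : ℝ) : ℂ) (ofRealVec q)) := by
  have hππ : -π ≤ π := by linarith [Real.pi_pos]
  intro j hj
  rcases j with _ | j
  · rw [D2N_zero_slice hq hq0 ⟨le_rfl, hππ⟩, D2N_zero_slice hq hq0 ⟨hππ, le_rfl⟩]
    exact E2_hper hq 0
  · exact E2_hper hq (j + 1)

/-- [our object] the top members are a.e.-strongly measurable on `[−π, π]` (they are continuous there). -/
theorem D1N_hmeas (hq : q ∈ BZ d) (hq0 : q ≠ 0) :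
    AEStronglyMeasurable (fun s : ℝ => D1N μ i α β 4 (i.insertNth (s : ℂ) (ofRealVec q))) (volume.restrict (Icc (-π) π)) := by
  have h := E1_hcont (μ := μ) (i := i) (α := α) (β := β) hq hq0 (k := 4) (by norm_num)
  rw [Set.uIcc_of_le (by linarith [Real.pi_pos])] at h
  exact h.aestronglyMeasurable measurableSet_Icc

/-- [our object] … and for the two-character chain. -/
theorem D2N_hmeas (hq : q ∈ BZ d) (hq0 : q ≠ 0) :
    AEStronglyMeasurable (fun s : ℝ => D2N μ ν i α β 5 (i.insertNth (s : ℂ) (ofRealVec q))) (volume.restrict (Icc (-π) π)) := by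
  have h := E2_hcont (μ := μ) (ν := ν) (i := i) (α := α) (β := β) hq hq0 (k := 5) (by norm_num)
  rw [Set.uIcc_of_le (by linarith [Real.pi_pos])] at h
  exact h.aestronglyMeasurable measurableSet_Icc

/-- [our object] **THE MAJORANT OF THE TOP MEMBER OF `D1N`**: `‖D1N 4 (insertNth i t q)‖ ≤ (2⁴·KremPmax d·π⁴)·(‖insertNth i t q‖³)⁻¹` — degree `−3`,
integrable on `BZ (d+1)` for `3 ≤ d`. -/
theorem D1N_hmaj (hq : q ∈ BZ d) (hq0 : q ≠ 0) {t : ℝ} (ht : t ∈ Icc (-π) π) :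
    ‖D1N μ i α β 4 (i.insertNth (t : ℂ) (ofRealVec q))‖ ≤ (2 ^ 4 * (KremPmax d * π ^ 4)) * (‖(i.insertNth t q : Fin (d + 1) → ℝ)‖ ^ 3)⁻¹ := by
  have h := E1_letter (μ := μ) (i := i) (α := α) (β := β) hq hq0 (k := 4) (by norm_num) ht
  have e : ‖(i.insertNth t q : Fin (d + 1) → ℝ)‖ ^ ((0 : ℤ) + 1 - (4 : ℕ)) = (‖(i.insertNth t q : Fin (d + 1) → ℝ)‖ ^ 3)⁻¹ := by
    rw [show (0 : ℤ) + 1 - (4 : ℕ) = -((3 : ℕ) : ℤ) by norm_num, zpow_neg, zpow_natCast]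
  rw [e] at h
  exact h

/-- [our object] **THE MAJORANT OF THE TOP MEMBER OF `D2N`**: `‖D2N 5 (insertNth i t q)‖ ≤ (2⁵·(2⁵π⁵·KremPmax d)·π⁵)·(‖insertNth i t q‖³)⁻¹`. -/
theorem D2N_hmaj (hq : q ∈ BZ d) (hq0 : q ≠ 0) {t : ℝ} (ht : t ∈ Icc (-π) π) :
    ‖D2N μ ν i α β 5 (i.insertNth (t : ℂ) (ofRealVec q))‖
      ≤ (2 ^ 5 * ((2 ^ 5 * π ^ 5 * KremPmax d) * π ^ 5)) * (‖(i.insertNth t q : Fin (d + 1) → ℝ)‖ ^ 3)⁻¹ := by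
  have h := E2_letter (μ := μ) (ν := ν) (i := i) (α := α) (β := β) hq hq0 (k := 5) (by norm_num) ht
  have e : ‖(i.insertNth t q : Fin (d + 1) → ℝ)‖ ^ ((1 : ℤ) + 1 - (5 : ℕ)) = (‖(i.insertNth t q : Fin (d + 1) → ℝ)‖ ^ 3)⁻¹ := by
    rw [show (1 : ℤ) + 1 - (5 : ℕ) = -((3 : ℕ) : ℤ) by norm_num, zpow_neg, zpow_natCast]
  rw [e] at h
  exact h

end Chains

/-! ## §5 (K2) and (K3) -/

/-- [our object] the constant of (K2): `CKB₂ d := (2π)^{−(d+1)}·∫_{BZ (d+1)} 2⁴·KremPmax d·π⁴·(‖s‖³)⁻¹ ds`. -/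
def CKB₂ (d : ℕ) : ℝ := ((2 * π) ^ (d + 1))⁻¹ * ∫ s in BZ (d + 1), (2 ^ 4 * (KremPmax d * π ^ 4)) * (‖s‖ ^ 3)⁻¹

/-- [our object] the constant of (K3): `CKB₃ d := (2π)^{−(d+1)}·∫_{BZ (d+1)} 2⁵·(2⁵π⁵·KremPmax d)·π⁵·(‖s‖³)⁻¹ ds`. -/
def CKB₃ (d : ℕ) : ℝ := ((2 * π) ^ (d + 1))⁻¹ * ∫ s in BZ (d + 1), (2 ^ 5 * ((2 ^ 5 * π ^ 5 * KremPmax d) * π ^ 5)) * (‖s‖ ^ 3)⁻¹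

/-- [our object] **(K2) THE FIRST DIFFERENCES OF THE REMAINDER KERNEL DECAY LIKE `‖z‖_∞^{−4}`**: for lattice dimension `d + 1 ≥ 4`, every direction `μ`
and `z ≠ 0`, `‖KB α β (z + e_μ) − KB α β z‖ ≤ CKB₂ d ∕ ‖z‖_∞⁴` — FOUR integrations by parts on the differenced symbol `(e^{ip_μ} − 1)·symB` along the
chain `D1N` (null set `{0}` of transverse momenta, majorant `∝ (‖s‖³)⁻¹ ∈ L¹` by `BrillouinRadial.integrableOn_inv_norm_pow_BZ`). -/
theorem norm_KB_fwdDiff_le_div_pow_four (hd : 3 ≤ d) (α β μ : Fin (d + 1)) {z : Fin (d + 1) → ℤ} (hz : z ≠ 0) :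
    ‖KB α β (z + Pi.single μ 1) - KB α β z‖ ≤ CKB₂ d / supNorm z ^ 4 := by
  haveI : Nonempty (Fin d) := ⟨⟨0, by omega⟩⟩
  have hN : volume ({0} : Set (Fin d → ℝ)) = 0 := measure_singleton 0
  have hg : IntegrableOn (fun s : Fin (d + 1) → ℝ => (2 ^ 4 * (KremPmax d * π ^ 4)) * (‖s‖ ^ 3)⁻¹) (BZ (d + 1)) volume :=
    (integrableOn_inv_norm_pow_BZ hd).const_mul _
  have hint : ∀ x, IntegrableOn (integrand (symB α β) x) (BZ (d + 1)) := fun x => integrableOn_integrand_symB α β x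
  have h := norm_latticeKernel_le_div_supNorm_pow_of_majorant (G := fun P => (cexp (I * P μ) - 1) * symB α β P) 4 (fun i => D1N μ i α β)
    (fun _ => rfl) {0} hN (integrableOn_integrand_chi_mul hint μ)
    (fun i j hj q hq hq0 t ht => D1N_hder hq hq0 j hj t ht)
    (fun i j hj q hq hq0 => D1N_hcont hq hq0 j hj)
    (fun i j hj q hq hq0 => D1N_hper hq hq0 j hj)
    (fun i q hq hq0 => D1N_hmeas hq hq0) hg
    (fun i q hq hq0 t ht => D1N_hmaj hq hq0 ht) z hz
  have e : KB α β (z + Pi.single μ 1) - KB α β z = latticeKernel (fun P => (cexp (I * P μ) - 1) * symB α β P) z :=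
    (latticeKernel_fwdDiff (symB α β) μ z (hint z) (hint _)).symm
  rw [e]
  exact h

/-- [our object] **(K3) THE MIXED SECOND DIFFERENCES OF THE REMAINDER KERNEL DECAY LIKE `‖z‖_∞^{−5}`**: for `d + 1 ≥ 4`, all directions `μ, ν` and `z ≠ 0`,
`‖KB α β (z + e_μ + e_ν) − KB α β (z + e_μ) − KB α β (z + e_ν) + KB α β z‖ ≤ CKB₃ d ∕ ‖z‖_∞⁵` — FIVE integrations by parts on `(e^{ip_ν} − 1)(e^{ip_μ} − 1)·symB`
along `D2N`. -/
theorem norm_KB_fwdDiff₂_le_div_pow_five (hd : 3 ≤ d) (α β μ ν : Fin (d + 1)) {z : Fin (d + 1) → ℤ} (hz : z ≠ 0) :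
    ‖KB α β (z + Pi.single μ 1 + Pi.single ν 1) - KB α β (z + Pi.single μ 1) - KB α β (z + Pi.single ν 1) + KB α β z‖ ≤ CKB₃ d / supNorm z ^ 5 := by
  haveI : Nonempty (Fin d) := ⟨⟨0, by omega⟩⟩
  have hN : volume ({0} : Set (Fin d → ℝ)) = 0 := measure_singleton 0
  have hg : IntegrableOn (fun s : Fin (d + 1) → ℝ => (2 ^ 5 * ((2 ^ 5 * π ^ 5 * KremPmax d) * π ^ 5)) * (‖s‖ ^ 3)⁻¹) (BZ (d + 1)) volume :=
    (integrableOn_inv_norm_pow_BZ hd).const_mul _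
  have hint : ∀ x, IntegrableOn (integrand (symB α β) x) (BZ (d + 1)) := fun x => integrableOn_integrand_symB α β x
  have h := norm_latticeKernel_le_div_supNorm_pow_of_majorant (G := fun P => (cexp (I * P ν) - 1) * ((cexp (I * P μ) - 1) * symB α β P)) 5
    (fun i => D2N μ ν i α β) (fun _ => rfl) {0} hN (integrableOn_integrand_chi_mul (integrableOn_integrand_chi_mul hint μ) ν)
    (fun i j hj q hq hq0 t ht => D2N_hder hq hq0 j hj t ht)
    (fun i j hj q hq hq0 => D2N_hcont hq hq0 j hj)
    (fun i j hj q hq hq0 => D2N_hper hq hq0 j hj)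
    (fun i q hq hq0 => D2N_hmeas hq hq0) hg
    (fun i q hq hq0 t ht => D2N_hmaj hq hq0 ht) z hz
  have e : KB α β (z + Pi.single μ 1 + Pi.single ν 1) - KB α β (z + Pi.single μ 1) - KB α β (z + Pi.single ν 1) + KB α β z
      = latticeKernel (fun P => (cexp (I * P ν) - 1) * ((cexp (I * P μ) - 1) * symB α β P)) z :=
    latticeKernel_fwdDiff₂ hint z μ ν
  rw [e]
  exact h

/-! ## §6 All-`z` letters in the consumers' currency -/

/-- [our object] `0 ≤ CKB₂ d` (`3 ≤ d`): (K2) at the point `e_0`. -/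
theorem CKB₂_nonneg (hd : 3 ≤ d) : 0 ≤ CKB₂ d := by
  have hz : (Pi.single (0 : Fin (d + 1)) (1 : ℤ) : Fin (d + 1) → ℤ) ≠ 0 := by
    intro h; have := congrFun h 0; simp at this
  have h := norm_KB_fwdDiff_le_div_pow_four hd 0 0 0 hz
  have hs : 0 < supNorm (Pi.single (0 : Fin (d + 1)) (1 : ℤ)) := lt_of_lt_of_le one_pos (one_le_supNorm hz)
  have h0 : 0 ≤ CKB₂ d / supNorm (Pi.single (0 : Fin (d + 1)) (1 : ℤ)) ^ 4 := (norm_nonneg _).trans h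
  by_contra hneg
  push Not at hneg
  have : CKB₂ d / supNorm (Pi.single (0 : Fin (d + 1)) (1 : ℤ)) ^ 4 < 0 := div_neg_of_neg_of_pos hneg (pow_pos hs 4)
  linarith

/-- [our object] `0 ≤ CKB₃ d` (`3 ≤ d`): (K3) at the point `e_0`. -/
theorem CKB₃_nonneg (hd : 3 ≤ d) : 0 ≤ CKB₃ d := by
  have hz : (Pi.single (0 : Fin (d + 1)) (1 : ℤ) : Fin (d + 1) → ℤ) ≠ 0 := by
    intro h; have := congrFun h 0; simp at this
  have h := norm_KB_fwdDiff₂_le_div_pow_five hd 0 0 0 0 hz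
  have hs : 0 < supNorm (Pi.single (0 : Fin (d + 1)) (1 : ℤ)) := lt_of_lt_of_le one_pos (one_le_supNorm hz)
  have h0 : 0 ≤ CKB₃ d / supNorm (Pi.single (0 : Fin (d + 1)) (1 : ℤ)) ^ 5 := (norm_nonneg _).trans h
  by_contra hneg
  push Not at hneg
  have : CKB₃ d / supNorm (Pi.single (0 : Fin (d + 1)) (1 : ℤ)) ^ 5 < 0 := div_neg_of_neg_of_pos hneg (pow_pos hs 5)
  linarith

/-- [our object] **(K2) FOR EVERY `z`, CONSUMERS' CURRENCY**: `‖KB α β (z + e_μ) − KB α β z‖ ≤ 16·(CKB₂ d + 2·CB0 d)∕(‖z‖_∞ + 1)⁴` (`z = 0` by the global bound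
`norm_KB_le`, `z ≠ 0` by §5 with `(‖z‖_∞ + 1)⁴ ≤ 16‖z‖_∞⁴`). -/
theorem norm_KB_fwdDiff_le_inv_succ_pow_four (hd : 3 ≤ d) (α β μ : Fin (d + 1)) (z : Fin (d + 1) → ℤ) :
    ‖KB α β (z + Pi.single μ 1) - KB α β z‖ ≤ 16 * (CKB₂ d + 2 * CB0 d) / (supNorm z + 1) ^ 4 := by
  have hC := CKB₂_nonneg hd; have hB := CB0_nonneg d
  by_cases hz : z = 0
  · have e : supNorm z = 0 := by rw [hz]; exact supNorm_zero'
    rw [e, zero_add, one_pow, div_one]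
    calc ‖KB α β (z + Pi.single μ 1) - KB α β z‖ ≤ ‖KB α β (z + Pi.single μ 1)‖ + ‖KB α β z‖ := norm_sub_le _ _
      _ ≤ CB0 d + CB0 d := add_le_add (norm_KB_le α β _) (norm_KB_le α β _)
      _ ≤ 16 * (CKB₂ d + 2 * CB0 d) := by linarith
  · set a := supNorm z with ha
    have ha1 : 1 ≤ a := one_le_supNorm hz
    have h1 := norm_KB_fwdDiff_le_div_pow_four hd α β μ hz
    have ha0 : 0 ≤ a := by linarith
    have h2 : CKB₂ d / a ^ 4 ≤ 16 * (CKB₂ d + 2 * CB0 d) / (a + 1) ^ 4 := by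
      rw [div_le_div_iff₀ (by positivity) (by positivity)]
      have h3 : (a + 1) ^ 4 ≤ (2 * a) ^ 4 := pow_le_pow_left₀ (by linarith) (by linarith) 4
      have h5 : (a + 1) ^ 4 ≤ 16 * a ^ 4 := by nlinarith
      calc CKB₂ d * (a + 1) ^ 4 ≤ CKB₂ d * (16 * a ^ 4) := mul_le_mul_of_nonneg_left h5 hC
        _ ≤ (CKB₂ d + 2 * CB0 d) * (16 * a ^ 4) := mul_le_mul_of_nonneg_right (by linarith) (by positivity)
        _ = 16 * (CKB₂ d + 2 * CB0 d) * a ^ 4 := by ring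
    exact h1.trans h2

/-- [our object] **(K3) FOR EVERY `z`, CONSUMERS' CURRENCY**: `‖KB α β (z + e_μ + e_ν) − KB α β (z + e_μ) − KB α β (z + e_ν) + KB α β z‖ ≤ 32·(CKB₃ d + 4·CB0 d)∕(‖z‖_∞ + 1)⁵`. -/
theorem norm_KB_fwdDiff₂_le_inv_succ_pow_five (hd : 3 ≤ d) (α β μ ν : Fin (d + 1)) (z : Fin (d + 1) → ℤ) :
    ‖KB α β (z + Pi.single μ 1 + Pi.single ν 1) - KB α β (z + Pi.single μ 1) - KB α β (z + Pi.single ν 1) + KB α β z‖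
      ≤ 32 * (CKB₃ d + 4 * CB0 d) / (supNorm z + 1) ^ 5 := by
  have hC := CKB₃_nonneg hd; have hB := CB0_nonneg d
  by_cases hz : z = 0
  · have e : supNorm z = 0 := by rw [hz]; exact supNorm_zero'
    rw [e, zero_add, one_pow, div_one]
    calc ‖KB α β (z + Pi.single μ 1 + Pi.single ν 1) - KB α β (z + Pi.single μ 1) - KB α β (z + Pi.single ν 1) + KB α β z‖
        ≤ ‖KB α β (z + Pi.single μ 1 + Pi.single ν 1) - KB α β (z + Pi.single μ 1) - KB α β (z + Pi.single ν 1)‖ + ‖KB α β z‖ := norm_add_le _ _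
      _ ≤ (‖KB α β (z + Pi.single μ 1 + Pi.single ν 1) - KB α β (z + Pi.single μ 1)‖ + ‖KB α β (z + Pi.single ν 1)‖) + ‖KB α β z‖ := by
          gcongr; exact norm_sub_le _ _
      _ ≤ ((‖KB α β (z + Pi.single μ 1 + Pi.single ν 1)‖ + ‖KB α β (z + Pi.single μ 1)‖) + ‖KB α β (z + Pi.single ν 1)‖) + ‖KB α β z‖ := by
          gcongr; exact norm_sub_le _ _
      _ ≤ ((CB0 d + CB0 d) + CB0 d) + CB0 d := by
          gcongr <;> exact norm_KB_le α β _
      _ ≤ 32 * (CKB₃ d + 4 * CB0 d) := by linarith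
  · set a := supNorm z with ha
    have ha1 : 1 ≤ a := one_le_supNorm hz
    have h1 := norm_KB_fwdDiff₂_le_div_pow_five hd α β μ ν hz
    have ha0 : 0 ≤ a := by linarith
    have h2 : CKB₃ d / a ^ 5 ≤ 32 * (CKB₃ d + 4 * CB0 d) / (a + 1) ^ 5 := by
      rw [div_le_div_iff₀ (by positivity) (by positivity)]
      have h3 : (a + 1) ^ 5 ≤ (2 * a) ^ 5 := pow_le_pow_left₀ (by linarith) (by linarith) 5
      have h5 : (a + 1) ^ 5 ≤ 32 * a ^ 5 := by nlinarith
      calc CKB₃ d * (a + 1) ^ 5 ≤ CKB₃ d * (32 * a ^ 5) := mul_le_mul_of_nonneg_left h5 hC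
        _ ≤ (CKB₃ d + 4 * CB0 d) * (32 * a ^ 5) := mul_le_mul_of_nonneg_right (by linarith) (by positivity)
        _ = 32 * (CKB₃ d + 4 * CB0 d) * a ^ 5 := by ring
    exact h1.trans h2

end Summit.QuantumFields.BalabanUV.Beta.FP.PerfectPropagatorKernelGraded

end
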